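import Literature.NumberTheory.EllipticCurves.ZpExtensionEisensteinOrdinaryTorsionCutReadoutProofs
import Literature.NumberTheory.EllipticCurves.ZpExtensionEisensteinDVRSettingH5bTorsionCutClauseProofs
import Literature.NumberTheory.EllipticCurves.ZpExtensionEisensteinPiTorsionCutH2OfBasisProofs
import HarnessLib

/-!
# Howard's H.5(b) at tower level `0` and the places `v ∣ p`, WITHOUT non-anomalous hypotheses
# (theorems only — no definition, no named fact, no instance, no `sorry`)

Topic `NumberTheory/EllipticCurves` (D1 road of cell `pub/bsd-print-x9`; brick (H5B-P-ANOM) of `Stmt.h5bAtS`, road «uniform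
involution» (U) of seat `bsd-line-x9-p1-w3` g6, file F7b; consumed by x10b-p1-w8's socket
`HeegnerMuPartH5bAtS.h5bAtSZeroP_of_clauseP`).

B. Howard, *The Heegner point Kolyvagin system*, Compositio Math. 140 (2004), §1.3 H.5(b) (arXiv:1202.6340 p. 7 L96–97):
`(θ_v ∘ transport_v)(F̄_𝔮(σ v)) = F̄_𝔮(v)` for the curve's Eisenstein setting `WeierstrassCurve.eisensteinDVRSetting`
(`T_𝔮 = T_p E ⊗ Λ/(T^m + p)(ψ)`, `F_𝔮` of Def. 3.1.2 with the ordinary data `Fil_w E[p^j]` at `w ∣ p`), at tower level `0` and a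
place `v ∋ p` such that at `w = v` and `w = σ v` the curve has good reduction with an ordinary point, `κ` is anticyclotomic for
the conjugation, and the decomposition groups have open image under `κ` (`κ(g_w) = p^{s_w}`, frame data), for every
`m ≥ 5 p^{s_w} + 1`: **`WeierstrassCurve.eisensteinDVRSetting_h5b_clause_zero_of_mem_p`** — the ANOMALOUS places included
(`Ẽ_w(k_w)[p] ≠ 0`), where `F̄_𝔮(w)` is no longer the strict ordinary condition of `E[p]` (cf.
`ZpExtensionEisensteinSelmerH5bOrdinaryPlacesProofs`, non-anomalous case).

Assembly: the torsion-cut readout `propagate_eisensteinSelmerStructure_eq_map_torsionCut` (F7a) at `v` and `σ v` with ONE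
exponent `r = 2p^{S}`, `S = max(s_v, s_{σv})` (realised by `g_w^{p^{S − s_w}}`), `c = p^S`, `c' = 2p^S` (x10b-p1-w5/w6's
`piTorsionCut_hH2Fil_of_basis` / `piTorsionCut_hH2_of_basis`, x10b-p1-w6's `ordinaryFiltrationAt_hFsurj/_hbasis`), then the
transport step `eisensteinDVRSetting_h5b_clause_zero_of_torsionCut_readout` (F7b-core: `Θ₁ = ι₁ ⊗ τ`).
No summit statement is proved; BSD is not proved by any of this.

References: [Howard2004HeegnerKolyvagin] §1.3 H.5(b), Def. 3.1.2, §3.1–3.2, Lemma 3.2.7; [GreenbergLNM1716] §2;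
[MazurTateTeitelbaum1986Invent] Ch. I §17; [SerreGaloisCohomology1997] I §2.4, II §5.2.
-/

set_option autoImplicit false

noncomputable section

open Function NumberField IsDedekindDomain Field
open scoped NumberField TensorProduct ContRepresentation

namespace WeierstrassCurve

open Literature.NumberTheory.EllipticCurves Literature.NumberTheory.GaloisRepresentations
open Literature.NumberTheory.GaloisRepresentations.DiscreteGaloisModule
open Literature.NumberTheory.GaloisCohomology.Howard2004
open Literature.NumberTheory.EllipticCurves.IwasawaAlgebra Literature.NumberTheory.EllipticCurves.ZpExtension

variable {K : Type} [Field K] [NumberField K] (W : WeierstrassCurve ℚ) [W.IsElliptic] {p : ℕ} [hp : Fact p.Prime]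
  (κ : ZpExtension K p) {m : ℕ} (hm : 1 ≤ m)
  (S : Finset (HeightOneSpectrum (𝓞 K)))
  (hpS : ∀ v : HeightOneSpectrum (𝓞 K), ((p : ℕ) : 𝓞 K) ∈ v.asIdeal → v ∈ S)
  (hbad : ∀ v : HeightOneSpectrum (𝓞 K), v ∉ S → ((p : ℕ) : 𝓞 K) ∉ v.asIdeal → (W.baseChange K).HasGoodReductionAt v)
  (L : Set (HeightOneSpectrum (𝓞 K)))
  (hL : letI := IwasawaAlgebra.isLocalRing_quotient_X_pow_add_C p hm
    L ⊆ (W.eisensteinTower κ hm).degreeTwoPrimes p)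
  (hLS : ∀ v ∈ L, v ∉ S)
  (jbar : AlgebraicClosure K →+* ℂ)
  (σ : K ≃ₐ[ℚ] K) (hσ₁ : σ ≠ 1) (hσ : σ * σ = 1) (τ : AlgebraicClosure K ≃+* AlgebraicClosure K)
  (hτ : IsLiftOfAut σ τ) (hτ₂ : Function.Involutive τ)
  (D : letI := IwasawaAlgebra.isLocalRing_quotient_X_pow_add_C p hm
    ∀ k, DualityDatum p (ConjugationDatum.ofLifts σ hσ₁ hσ τ hτ hτ₂) ((W.eisensteinTower κ hm).ρ k)
      (IwasawaAlgebra.EisensteinCoeff p m (k + 1)))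
  (fs : letI := IwasawaAlgebra.isLocalRing_quotient_X_pow_add_C p hm
    ∀ (k : ℕ) (n : Finset (HeightOneSpectrum (𝓞 K))) (v : HeightOneSpectrum (𝓞 K)),
      galoisCohomology ((W.eisensteinLevelQuot κ hm k n).toLocal (Sum.inr v)) 1 →+
        SingularQuotient (GaloisRep.toLocal v (W.eisensteinLevelQuot κ hm k n)) ⊗[ℤ] Gell v)

/-- **The torsion-cut readout for the curve's Eisenstein DVR setting at tower level `0` and a place `w ∋ p`** of good
reduction with an ordinary point, for an element `g₀ ∈ Γ_{K_w}` with `κ(g₀) = p^s` and `5p^s + 1 ≤ m`: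
`F̄_𝔮(w) = π̄_* {y ∈ H¹(K_w, W₁) : [T]^{2p^s} y ∈ H¹_str(K_w, Fil_w W₁)}` (F7a with the (F1b-INST)/(F4) discharges).
[cite: Howard2004HeegnerKolyvagin, §1.3 H.5(b), Def. 3.1.2, §3.1 and Lemma 3.2.7 (arXiv:1202.6340 p. 7 L96–97, p. 15 L99–108, p. 16 L142–160)]
[cite: GreenbergLNM1716, §2] -/
theorem propagate_eisensteinTowerTriple_zero_eq_map_torsionCut {w : HeightOneSpectrum (𝓞 K)}
    (hpw : ((p : ℕ) : 𝓞 K) ∈ w.asIdeal) (hgood : (W.baseChange K).HasGoodReductionAt w)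
    (hord : ∃ P : localPoints (W.baseChange K) (w.adicCompletion K),
      (p : ℤ) • P = 0 ∧ P ∉ (W.baseChange K).localKernelOfReduction w)
    {g₀ : absoluteGaloisGroup (w.adicCompletion K)} {s : ℕ}
    (hg₀ : (κ (absGaloisRestrict K (w.adicCompletion K) g₀)).toAdd = ((p ^ s : ℕ) : ℤ_[p])) (hms : 5 * p ^ s + 1 ≤ m) :
    letI := IwasawaAlgebra.isDomain_quotient_X_pow_add_C p hm
    letI := IwasawaAlgebra.isDiscreteValuationRing_quotient_X_pow_add_C p hm
    haveI := IwasawaAlgebra.EisensteinCoeff.isLocalRing_succ p hm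
    letI := IwasawaAlgebra.EisensteinCoeff.algebraOfSpecSucc p m
    haveI := W.isScalarTower_algebraOfSpecSucc (K := K) (p := p) (m := m)
    letI := W.residueModuleSucc (K := K) (p := p) hm
    ((W.isQuotientBy_eisensteinDVRSetting_πbar κ hm S hpS hbad L hL hLS jbar
        (ConjugationDatum.ofLifts σ hσ₁ hσ τ hτ hτ₂) D fs 0).propagateStructure
      (W.eisensteinTowerTriple κ hm S hpS hbad L hL hLS 0).cond) (Sum.inr w) =
    ((((κ.eisensteinTwist ((W.baseChange K).torsionGaloisModule ((p : ℤ) ^ 1)) hm 1).toLocal (Sum.inr w)).strictSubgroup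
        (((W.baseChange K).ordinaryFiltrationAt w (fun j ↦ (W.baseChange K).torsionGaloisModuleReduce p j)
          (fun _ _ ↦ rfl)).twistedFil (p := p) (m := m) 1)
        (fun g _ hx ↦ ((W.baseChange K).ordinaryFiltrationAt w (fun j ↦ (W.baseChange K).torsionGaloisModuleReduce p j)
          (fun _ _ ↦ rfl)).twistedFil_le_comap hm 1 g hx)).comap
      (galoisCohomology.scalarMapH1 _
        ((κ.isScalarLinear_eisensteinTwist ((W.baseChange K).torsionGaloisModule ((p : ℤ) ^ 1)) hm 1).restrictField _)
        ((Ideal.Quotient.mk _ PowerSeries.X : EisensteinCoeff p m 1) ^ (2 * p ^ s)))).map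
      ((W.isQuotientBy_eisensteinDVRSetting_πbar κ hm S hpS hbad L hL hLS jbar
        (ConjugationDatum.ofLifts σ hσ₁ hσ τ hτ hτ₂) D fs 0).localCohomologyMap (Sum.inr w) 1) := by
  letI := IwasawaAlgebra.isDomain_quotient_X_pow_add_C p hm
  letI := IwasawaAlgebra.isDiscreteValuationRing_quotient_X_pow_add_C p hm
  haveI := IwasawaAlgebra.EisensteinCoeff.isLocalRing_succ p hm
  letI := IwasawaAlgebra.EisensteinCoeff.algebraOfSpecSucc p m
  haveI := W.isScalarTower_algebraOfSpecSucc (K := K) (p := p) (m := m)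
  letI := W.residueModuleSucc (K := K) (p := p) hm
  have hFsurj := (W.baseChange K).ordinaryFiltrationAt_hFsurj (p := p) w hgood hpw hord
  have hbasis := (W.baseChange K).ordinaryFiltrationAt_hbasis (p := p) w hgood hpw hord
  have hms1 : p ^ s < m := by omega
  obtain ⟨t, ht⟩ := (W.baseChange K).exists_piFil_subPowFamily_apply κ hm w
    ((W.baseChange K).ordinaryFiltrationAt w (fun j ↦ (W.baseChange K).torsionGaloisModuleReduce p j) (fun _ _ ↦ rfl))
    (p ^ s)
  exact (W.baseChange K).propagate_eisensteinSelmerStructure_eq_map_torsionCut κ hm S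
    (fun v _ ↦ (W.baseChange K).ordinaryFiltrationAt v (fun j ↦ (W.baseChange K).torsionGaloisModuleReduce p j)
      (fun _ _ ↦ rfl))
    w hpw _ (W.isQuotientBy_eisensteinDVRSetting_πbar κ hm S hpS hbad L hL hLS jbar
      (ConjugationDatum.ofLifts σ hσ₁ hσ τ hτ hτ₂) D fs 0)
    hFsurj hbasis hg₀ (by omega) t (p ^ s) ht
    (fun j z ↦ (W.baseChange K).piTorsionCut_hH2Fil_of_basis κ hm w _ hbasis hg₀ hms1 j (t j) (ht j) z)
    (fun j z ↦ (W.baseChange K).piTorsionCut_hH2_of_basis κ hm w _ hbasis hg₀ hms1 j z)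
    (by omega)

/-- **H.5(b), bottom level, at `v ∈ S` above `p`, anomalous places included** (the `hfin` clause of `eisensteinDVRSetting_h5b_of`
at `k = 0`, conjugation datum `ConjugationDatum.ofLifts σ …`; x10b-p1-w8's HF7 letter): if `p ∈ v`, `p ∈ σ v`, at `w = v` and
`w = σ v` the curve has good reduction with an ordinary point, `κ` is anticyclotomic for the conjugation, and elements
`g_w ∈ Γ_{K_w}` with `κ(g_w) = p^{s_w}` and `5 p^{s_w} + 1 ≤ m` are given, then `(θ_v ∘ transport_v)(F̄_𝔮(σ v)) = F̄_𝔮(v)` at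
tower level `0`.  No «non-anomalous» hypothesis: the residual images are the `π̄`-images of the torsion cuts of `W₁`, which the
`ι₁`-semilinear involution `Θ₁ = ι₁ ⊗ τ` transports.
[cite: Howard2004HeegnerKolyvagin, §1.3 H.5(b), Def. 3.1.2, §3.1–3.2 and Lemma 3.2.7 (arXiv:1202.6340 p. 7 L93–97 and L108–113, p. 15 L99–108, p. 16 L5–6, L116–123 and L142–160)]
[cite: GreenbergLNM1716, §2] [cite: MazurTateTeitelbaum1986Invent, Ch. I §17] [cite: SerreGaloisCohomology1997, I §2.4 and II §5.2] -/
theorem eisensteinDVRSetting_h5b_clause_zero_of_mem_p {v : HeightOneSpectrum (𝓞 K)}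
    (hpv : ((p : ℕ) : 𝓞 K) ∈ v.asIdeal)
    (hpσv : ((p : ℕ) : 𝓞 K) ∈ ((ConjugationDatum.ofLifts σ hσ₁ hσ τ hτ hτ₂).σ • v).asIdeal)
    (hgood : ∀ w ∈ ({v, (ConjugationDatum.ofLifts σ hσ₁ hσ τ hτ hτ₂).σ • v} : Set (HeightOneSpectrum (𝓞 K))),
      (W.baseChange K).HasGoodReductionAt w)
    (hord : ∀ w ∈ ({v, (ConjugationDatum.ofLifts σ hσ₁ hσ τ hτ hτ₂).σ • v} : Set (HeightOneSpectrum (𝓞 K))),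
      ∃ P : localPoints (W.baseChange K) (w.adicCompletion K), (p : ℤ) • P = 0 ∧ P ∉ (W.baseChange K).localKernelOfReduction w)
    (hanti : ∀ g : absoluteGaloisGroup K,
      (κ ((ConjugationDatum.ofLifts σ hσ₁ hσ τ hτ hτ₂).conj g)).toAdd = -(κ g).toAdd)
    {s : HeightOneSpectrum (𝓞 K) → ℕ} {g : ∀ w : HeightOneSpectrum (𝓞 K), absoluteGaloisGroup (w.adicCompletion K)}
    (hg : ∀ w ∈ ({v, (ConjugationDatum.ofLifts σ hσ₁ hσ τ hτ hτ₂).σ • v} : Set (HeightOneSpectrum (𝓞 K))),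
      (κ (absGaloisRestrict K (w.adicCompletion K) (g w))).toAdd = ((p ^ s w : ℕ) : ℤ_[p]))
    (hms : ∀ w ∈ ({v, (ConjugationDatum.ofLifts σ hσ₁ hσ τ hτ hτ₂).σ • v} : Set (HeightOneSpectrum (𝓞 K))),
      5 * p ^ s w + 1 ≤ m) :
    letI := IwasawaAlgebra.isDomain_quotient_X_pow_add_C p hm
    letI := IwasawaAlgebra.isDiscreteValuationRing_quotient_X_pow_add_C p hm
    haveI := IwasawaAlgebra.EisensteinCoeff.isLocalRing_succ p hm
    letI := IwasawaAlgebra.EisensteinCoeff.algebraOfSpecSucc p m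
    haveI := W.isScalarTower_algebraOfSpecSucc (K := K) (p := p) (m := m)
    letI := W.residueModuleSucc (K := K) (p := p) hm
    AddSubgroup.map
        (((W.residualTauGeomTorsion (p := p) (ConjugationDatum.ofLifts σ hσ₁ hσ τ hτ hτ₂) hm (k := 0 + 1)
            (Nat.succ_pos 0)).thetaH1 (Sum.inr v)).comp
          ((ConjugationDatum.ofLifts σ hσ₁ hσ τ hτ hτ₂).transportH1 ((W.baseChange K).torsionGaloisModule (p : ℤ)) v))
        (((W.isQuotientBy_eisensteinDVRSetting_πbar κ hm S hpS hbad L hL hLS jbar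
            (ConjugationDatum.ofLifts σ hσ₁ hσ τ hτ hτ₂) D fs 0).propagateStructure
          (W.eisensteinTowerTriple κ hm S hpS hbad L hL hLS 0).cond)
          (Sum.inr ((ConjugationDatum.ofLifts σ hσ₁ hσ τ hτ hτ₂).σ • v))) =
      ((W.isQuotientBy_eisensteinDVRSetting_πbar κ hm S hpS hbad L hL hLS jbar
          (ConjugationDatum.ofLifts σ hσ₁ hσ τ hτ hτ₂) D fs 0).propagateStructure
        (W.eisensteinTowerTriple κ hm S hpS hbad L hL hLS 0).cond) (Sum.inr v) := by
  -- `p ∈ w` for both places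
  have hpw : ∀ w ∈ ({v, (ConjugationDatum.ofLifts σ hσ₁ hσ τ hτ hτ₂).σ • v} : Set (HeightOneSpectrum (𝓞 K))),
      ((p : ℕ) : 𝓞 K) ∈ w.asIdeal := by
    intro w hw
    rcases hw with rfl | hw
    · exact hpv
    · rw [Set.mem_singleton_iff] at hw
      rw [hw]
      exact hpσv
  -- ONE exponent `S' = max (s v) (s σv)` at both places, realised by `g_w ^ p^(S' - s w)`
  have hle : ∀ w ∈ ({v, (ConjugationDatum.ofLifts σ hσ₁ hσ τ hτ hτ₂).σ • v} : Set (HeightOneSpectrum (𝓞 K))),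
      s w ≤ max (s v) (s ((ConjugationDatum.ofLifts σ hσ₁ hσ τ hτ hτ₂).σ • v)) := by
    intro w hw
    rcases hw with rfl | hw
    · exact le_max_left _ _
    · rw [Set.mem_singleton_iff] at hw
      rw [hw]
      exact le_max_right _ _
  have hmS : 5 * p ^ max (s v) (s ((ConjugationDatum.ofLifts σ hσ₁ hσ τ hτ hτ₂).σ • v)) + 1 ≤ m := by
    rcases le_total (s v) (s ((ConjugationDatum.ofLifts σ hσ₁ hσ τ hτ hτ₂).σ • v)) with h | h
    · rw [max_eq_right h]; exact hms _ (by simp)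
    · rw [max_eq_left h]; exact hms _ (by simp)
  have hg' : ∀ w ∈ ({v, (ConjugationDatum.ofLifts σ hσ₁ hσ τ hτ hτ₂).σ • v} : Set (HeightOneSpectrum (𝓞 K))),
      (κ (absGaloisRestrict K (w.adicCompletion K)
        (g w ^ p ^ (max (s v) (s ((ConjugationDatum.ofLifts σ hσ₁ hσ τ hτ hτ₂).σ • v)) - s w)))).toAdd =
        ((p ^ max (s v) (s ((ConjugationDatum.ofLifts σ hσ₁ hσ τ hτ hτ₂).σ • v)) : ℕ) : ℤ_[p]) := by
    intro w hw
    rw [map_pow, map_pow, toAdd_pow, hg w hw, nsmul_eq_mul, ← Nat.cast_mul, ← pow_add, Nat.sub_add_cancel (hle w hw)]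
  exact W.eisensteinDVRSetting_h5b_clause_zero_of_torsionCut_readout κ hm S hpS hbad L hL hLS jbar σ hσ₁ hσ τ hτ hτ₂ D fs
    hanti (fun w hw ↦ W.propagate_eisensteinTowerTriple_zero_eq_map_torsionCut κ hm S hpS hbad L hL hLS jbar σ hσ₁ hσ τ hτ
      hτ₂ D fs (hpw w hw) (hgood w hw) (hord w hw) (hg' w hw) hmS)

end WeierstrassCurve

end
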